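import Summits.RiemannHypothesis.RiemannHypothesis.Theorems.JensenPolynomialsSqrtLogRangeExplicit
import Literature.NumberTheory.LFunctions.JensenXiFixedDegree

/-!
# The two PRINTED open-ended tails of the Jensen column DISCHARGED as kernel theorems:
# GORTTW 2022 Thm. 1.1 (`n > c·e^{d}`) and Kim–Lee 2021 Thm. 1 (`N(Ξ₀; d) = O(d^{c})`, `c > ½`)
# (RH-FREE; cell rh-jensen, HUMAN RULING D-0040, ladder RH column JENSEN rung J-P(P1″))

RH-FREE. `Literature/NumberTheory/LFunctions/JensenXiFixedDegree.lean` types, AS PRINTED and as NAMED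
FACTS (not proved there — "the two genuinely open-ended printed tails, all `d`, not implied by any
finite height"):

* `gorttw_thm1_1 : ∃ c > 0, ∀ d n, 1 ≤ d → c·e^{d} < n → J^{d,n}_γ hyperbolic`
  [GriffinEtAl2022, Thm. 1.1; the constant `c` is absolute and uncomputed in print];
* `kimLee_thm1 : ∀ c > ½, ∃ C d₀, ∀ d ≥ d₀, ∃ N ≤ C·d^{c}, JensenHyperbolicFrom xiTaylorCoeff d N`
  [KimLee2021, Thm. 1; INEFFECTIVE in print].

Both follow at once from the column's explicit threshold `N(d) ≤ 40√d·log(20√d)`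
(`KimLee.jensenPoly_xiTaylorCoeff_splits_of_ge`, `KimLee.jensenHyperbolicFrom_xiTaylorCoeff_sqrtLog`,
file `JensenPolynomialsSqrtLogRangeExplicit.lean`; rung J-P(P1″)):

* `gorttw_thm1_1_holds : gorttw_thm1_1` with the EXPLICIT constant `c = 800`
  (`40√d·log(20√d) ≤ 40√d·20√d = 800d ≤ 800e^{d}`);
* `kimLee_thm1_holds : kimLee_thm1` with the EXPLICIT `C = 40·20^{2c−1}/(2c−1) + 1`, `d₀ = 1`,
  `N = ⌈40√d·log(20√d)⌉₊` (`log x ≤ x^{η}/η`, `η = 2c − 1`, Mathlib `Real.log_le_rpow_div`).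

So the tree's chain of Jensen tails for `γ = xiTaylorCoeff` — GORZ 2019 Thm. 1 (`∃ N(d)`), GORTTW
2022 (`c·e^{d}`), the cubic rung `JensenCubicRangeTwo` (`2d³`), Kim–Lee (`O(d^{1/2+ε})`) — is now
hypothesis-free in the kernel, with `N(d) = O(√d·log d)` explicit. WHAT THIS IS NOT: every statement
here is a hyperbolicity RANGE with `N(d) → ∞`, inside Farmer's class (tree barriers
`Literature.Barriers.RiemannHypothesis.JensenPolynomials{,ShiftUniform,Sqrt,Cone}`): nothing here bears
on zeros of `ζ` off the critical line or on the truth of RH. Landed `--supports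
stmt-RiemannHypothesis-19715` by prover-rh-jensen-prover-g6-0.

## References
* [GriffinEtAl2022] Griffin–Ono–Rolen–Thorner–Tripp–Wagner, Adv. Math. 397 (2022) 108186, Thm. 1.1.
* [KimLee2021] Y.-O. Kim, J. Lee, J. Korean Math. Soc. 59 (2022) 775–787 = arXiv:2105.05386, Thm. 1.
-/

noncomputable section
-- D-0017: `Summit.RiemannHypothesis.RiemannHypothesis.…` duplicates the namespace BY DESIGN (single-problem summit).
set_option linter.dupNamespace false

open Polynomial

namespace Summit.RiemannHypothesis.RiemannHypothesis.Theorems.JensenPolynomials.KimLee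

open Literature.NumberTheory.LFunctions

/-- For `d ≥ 1`: `40√d·log(20√d) ≤ 800·d`. [folklore] -/
theorem threshold_le_800_mul {d : ℕ} (hd : 1 ≤ d) :
    40 * Real.sqrt d * Real.log (20 * Real.sqrt d) ≤ 800 * d := by
  have hd0 : (0 : ℝ) < d := by exact_mod_cast hd
  have hs : 0 < Real.sqrt d := Real.sqrt_pos.2 hd0
  have hs2 : Real.sqrt d ^ 2 = d := Real.sq_sqrt hd0.le
  have hlog : Real.log (20 * Real.sqrt d) ≤ 20 * Real.sqrt d := by
    have := Real.log_le_sub_one_of_pos (by positivity : 0 < 20 * Real.sqrt d); linarith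
  calc 40 * Real.sqrt d * Real.log (20 * Real.sqrt d)
      ≤ 40 * Real.sqrt d * (20 * Real.sqrt d) := mul_le_mul_of_nonneg_left hlog (by positivity)
    _ = 800 * Real.sqrt d ^ 2 := by ring
    _ = 800 * d := by rw [hs2]

/-- **GORTTW 2022, Thm. 1.1 — DISCHARGED with the explicit constant `c = 800` (RH-FREE):** there is
`c > 0` (namely `800`) such that for all `d ≥ 1` and `n > c·e^{d}`, `J^{d,n}_γ` is hyperbolic.
(From `N(d) ≤ 40√d·log(20√d) ≤ 800d ≤ 800e^{d}`.) [cite: GriffinEtAl2022, Theorem 1.1] -/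
theorem gorttw_thm1_1_holds : gorttw_thm1_1 := by
  refine ⟨800, by norm_num, fun d n hd hn ↦ ?_⟩
  refine jensenPoly_xiTaylorCoeff_splits_of_ge d n ?_
  have h1 := threshold_le_800_mul hd
  have h2 : (d : ℝ) ≤ Real.exp d := by
    have := Real.add_one_le_exp (d : ℝ); linarith
  nlinarith

/-- For `d ≥ 1` and `η > 0`: `40√d·log(20√d) ≤ (40·20^{η}/η)·d^{(1+η)/2}` (`log x ≤ x^{η}/η`).
[folklore] -/
theorem threshold_le_rpow {d : ℕ} (hd : 1 ≤ d) {η : ℝ} (hη : 0 < η) :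
    40 * Real.sqrt d * Real.log (20 * Real.sqrt d) ≤
      40 * (20 : ℝ) ^ η / η * (d : ℝ) ^ ((1 + η) / 2) := by
  have hd0 : (0 : ℝ) < d := by exact_mod_cast hd
  set s : ℝ := Real.sqrt d with hsdef
  have hs : 0 < s := Real.sqrt_pos.2 hd0
  have hlog : Real.log (20 * s) ≤ (20 * s) ^ η / η :=
    Real.log_le_rpow_div (by positivity) hη
  have hmul : (20 * s) ^ η = (20 : ℝ) ^ η * s ^ η := Real.mul_rpow (by norm_num) hs.le
  -- `s · s^η = s^{1+η} = d^{(1+η)/2}`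
  have hpow : s * s ^ η = (d : ℝ) ^ ((1 + η) / 2) := by
    have h1 : s * s ^ η = s ^ (1 + η) := by
      rw [Real.rpow_add hs, Real.rpow_one]
    have h2 : s = (d : ℝ) ^ (1 / 2 : ℝ) := by rw [hsdef, Real.sqrt_eq_rpow]
    rw [h1, h2, ← Real.rpow_mul hd0.le]
    congr 1; ring
  calc 40 * s * Real.log (20 * s) ≤ 40 * s * ((20 * s) ^ η / η) :=
        mul_le_mul_of_nonneg_left hlog (by positivity)
    _ = 40 * (20 : ℝ) ^ η / η * (s * s ^ η) := by rw [hmul]; ring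
    _ = 40 * (20 : ℝ) ^ η / η * (d : ℝ) ^ ((1 + η) / 2) := by rw [hpow]

/-- **Kim–Lee 2021, Thm. 1 for `Ξ₀` — DISCHARGED and made EFFECTIVE (RH-FREE):** for every `c > ½`,
with `C = 40·20^{2c−1}/(2c−1) + 1` and `d₀ = 1`, every degree `d ≥ 1` has a shift threshold
`N = ⌈40√d·log(20√d)⌉₊ ≤ C·d^{c}` with `J^{d,n}_γ` hyperbolic for all `n ≥ N` (in print:
`N(Ξ₀; d) = O(d^{c})`, ineffective). [cite: KimLee2021, Theorem 1] -/
theorem kimLee_thm1_holds : kimLee_thm1 := by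
  intro c hc
  set η : ℝ := 2 * c - 1 with hη
  have hη0 : 0 < η := by rw [hη]; linarith
  refine ⟨40 * (20 : ℝ) ^ η / η + 1, 1, fun d hd ↦ ?_⟩
  refine ⟨⌈40 * Real.sqrt d * Real.log (20 * Real.sqrt d)⌉₊, ?_,
    jensenHyperbolicFrom_xiTaylorCoeff_sqrtLog d⟩
  have hd1 : (1 : ℝ) ≤ d := by exact_mod_cast hd
  have hd0 : (0 : ℝ) < d := by linarith
  have hs1 : 1 ≤ Real.sqrt d := by rw [← Real.sqrt_one]; exact Real.sqrt_le_sqrt hd1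
  -- the threshold is nonnegative
  have hx0 : 0 ≤ 40 * Real.sqrt d * Real.log (20 * Real.sqrt d) := by
    have : 0 ≤ Real.log (20 * Real.sqrt d) := Real.log_nonneg (by linarith)
    positivity
  have hceil : ((⌈40 * Real.sqrt d * Real.log (20 * Real.sqrt d)⌉₊ : ℕ) : ℝ) <
      40 * Real.sqrt d * Real.log (20 * Real.sqrt d) + 1 := Nat.ceil_lt_add_one hx0
  have hmain := threshold_le_rpow hd hη0
  have hexp : (1 + η) / 2 = c := by rw [hη]; ring
  rw [hexp] at hmain
  have hone : (1 : ℝ) ≤ (d : ℝ) ^ c := Real.one_le_rpow hd1 (by linarith)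
  have hK : 0 ≤ 40 * (20 : ℝ) ^ η / η := by positivity
  calc ((⌈40 * Real.sqrt d * Real.log (20 * Real.sqrt d)⌉₊ : ℕ) : ℝ)
      ≤ 40 * Real.sqrt d * Real.log (20 * Real.sqrt d) + 1 := hceil.le
    _ ≤ 40 * (20 : ℝ) ^ η / η * (d : ℝ) ^ c + 1 * (d : ℝ) ^ c := by linarith [hmain, hone]
    _ = (40 * (20 : ℝ) ^ η / η + 1) * (d : ℝ) ^ c := by ring

end Summit.RiemannHypothesis.RiemannHypothesis.Theorems.JensenPolynomials.KimLee

end
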